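import Literature.NumberTheory.EllipticCurves.CyclotomicPAdicLFunctionWeightKDatumProofs
import Literature.NumberTheory.EllipticCurves.PAdicMeasureTransformAlgCl
import Literature.NumberTheory.EllipticCurves.ModularSymbolsManinDrinfeldGeneralProofs
import Literature.NumberTheory.EllipticCurves.GreenbergSelmerCharIdealPrincipalProofs
import HarnessLib

/-!
# Existence of the cyclotomic `p`-adic `L`-function of an ordinary newform of weight `k ≥ 2` with
# coefficients in `ℚ̄_p` — discharge of the named fact `exists_isCycPAdicLFunctionWeightK`
# (Mazur–Tate–Teitelbaum 1986, §I.10–I.14)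

Topic `Literature/NumberTheory/EllipticCurves`, namespace
`Literature.NumberTheory.EllipticCurves.ModularForms`.

`CyclotomicPAdicLFunctionWeightK.lean` states, as a named fact (D-0014), the existence of the
cyclotomic `p`-adic `L`-function `L_p(g, υ; T) ∈ ℚ̄_p⟦T⟧` of the `ι`-ordinary `p`-stabilisation of
a newform `g ∈ S_k(Γ₀(M))`, `k ≥ 2`, `p ∤ M`, normalised by a period–symbol datum `D = (Ω, σ)`
(`IsCycPAdicLFunctionWeightK g D p ι υ L`: constant term
`(1 − υ⁻¹)(1 − p^{k−2}υ⁻¹) ι[0]_g` and the values `υ^{−m} ∑_a χ(a) ι[a/pᵐ]_g` at the even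
`p`-power-order primitive characters of conductor `pᵐ`), bounded, with coefficients in a finite
extension of `ℚ_p`.  This file PROVES it (`exists_isCycPAdicLFunctionWeightK_holds`):

* the distribution `μ(a + pᵐℤ_p) = υ^{−m}(ι σ(a/pᵐ) − p^{k−2}υ⁻¹ ι σ(a/p^{m−1}))` of the datum
  (`CyclotomicPAdicLFunctionWeightKDatumProofs`: distribution relation from `T_p g = a_p g`,
  values, membership in `ℚ_p(ι K_g, υ)`);
* **bounded denominators** (`PeriodSymbolDatum.exists_norm_le_of_fg`): if the ray integrals
  `∫_r^{i∞} g dz` at the admissible cusps lie in a finitely generated subgroup `Λ ⊂ ℂ`, then the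
  symbols `σ(r) ∈ K_g` lie in the finitely generated group `{q ∈ K_g : qΩ ∈ Im Λ}` (a subgroup of a
  finitely generated `ℤ`-module; `ℤ` is Noetherian), so `‖ι σ(r)‖` is bounded (`ℚ̄_p` is
  ultrametric) — WITHOUT identifying `Ω` with a Shimura period; the input `Λ` is Manin's theorem:
  in weight `2` the period lattice and the uniform Manin–Drinfeld denominator
  (`periodLattice_fg`, `exists_forall_nsmul_modularSymbol_mem_periodLattice`,
  `exists_nsmul_modularSymbol_mem_periodLattice_holds`), in even weight `≥ 4` the tree's
  `IsNewform0.exists_fg_rayMoment_rat_mem` (Shimura 1977 / Manin 1973); odd weight does not occur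
  on `Γ₀(M)` (`−1 ∈ Γ₀(M)`, the tree's `eq_zero_of_odd_weight_gamma0`);
* the `ℚ̄_p`-valued Mellin transform `exists_powerSeries_of_bounded_distribution_algCl`
  (`PAdicMeasureTransformAlgCl`: coordinates over `ℚ_p` + the tree's `ℚ_p`-engine).

Everything is proved; there are no named facts (net named-fact debt −1).

References: B. Mazur, J. Tate, J. Teitelbaum, Invent. Math. 84 (1986), §I.10 (10.1)–(10.2), §I.11,
§I.13, §I.14 (14.3); Ju. I. Manin, Izv. 36 (1972), Cor. 3.6, and Mat. Sb. 92 (1973), Thm. 1.3;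
G. Shimura, Math. Ann. 229 (1977), Thm. 1; W. Stein, C. Wuthrich, Math. Comp. 82 (2013), §3.
-/

noncomputable section

open scoped MatrixGroups ModularForm
open CongruenceSubgroup Complex
open UpperHalfPlane hiding I

namespace Literature.NumberTheory.EllipticCurves.ModularForms

open Literature.NumberTheory.EllipticCurves

/-! ### Bounded denominators: from a finitely generated group of ray integrals to bounded symbols -/

section Bounded

variable {N : ℕ} [NeZero N] {p : ℕ} [Fact p.Prime] {k : ℤ} {g : CuspForm (Gamma0 N) k}

omit [NeZero N] in
/-- **Bounded symbols from bounded denominators** (Mazur–Tate–Teitelbaum 1986, §I.10–I.11; Manin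
1973, Thm. 1.3): if the ray integrals `∫_r^{i∞} g dz` at all admissible cusps `r` (`gcd(den r, N) = 1`)
lie in a finitely generated subgroup `Λ ⊂ ℂ`, then for a period–symbol datum `(Ω, σ)` and any ring
map `ι : K_g → ℚ̄_p` the values `ι σ(r)` are bounded.  Indeed `σ(r)Ω = Im ∫_r^{i∞} g dz ∈ Im Λ`, so
`σ(r)` lies in `T = {q ∈ K_g : qΩ ∈ Im Λ}`, which maps injectively into the finitely generated
`ℤ`-module `Im Λ` and is therefore finitely generated (`ℤ` Noetherian); `ι` is bounded on `T` since
`ℚ̄_p` is ultrametric and `‖n‖ ≤ 1` for `n ∈ ℤ`. [cite: MazurTateTeitelbaum1986Invent, §I.10–I.11] -/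
theorem PeriodSymbolDatum.exists_norm_le_of_fg (D : PeriodSymbolDatum g)
    (ι : coeffField g →+* PadicAlgCl p) {Λ : Submodule ℤ ℂ} (hΛ : Λ.FG)
    (hmem : ∀ r : ℚ, IsCoprime (r.den : ℤ) (N : ℤ) → rayMoment ⇑g 0 (r : ℝ) ∈ Λ) :
    ∃ B : ℝ, ∀ r : ℚ, IsCoprime (r.den : ℤ) (N : ℤ) → ‖ι (D.σ r)‖ ≤ B := by
  classical
  have hΩ : (D.Ω : ℂ) ≠ 0 := by exact_mod_cast D.Ω_ne_zero
  -- `Ψ q = q Ω`, `imZ z = Im z`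
  let Ψ : coeffField g →ₗ[ℤ] ℂ :=
    ((AddMonoidHom.mulRight (D.Ω : ℂ)).comp
      (coeffField g).val.toRingHom.toAddMonoidHom).toIntLinearMap
  have hΨ : ∀ q, Ψ q = (q : ℂ) * (D.Ω : ℂ) := fun q ↦ rfl
  let imZ : ℂ →ₗ[ℤ] ℂ := (Complex.ofRealAm.toRingHom.toAddMonoidHom.comp Complex.imAddGroupHom).toIntLinearMap
  have himZ : ∀ z : ℂ, imZ z = ((z.im : ℝ) : ℂ) := fun z ↦ rfl
  have hΨinj : Function.Injective Ψ := by
    intro a b h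
    rw [hΨ, hΨ] at h
    exact Subtype.ext (mul_right_cancel₀ hΩ h)
  -- `T = Ψ⁻¹(Im Λ)` is finitely generated
  set T : Submodule ℤ (coeffField g) := (Λ.map imZ).comap Ψ with hT
  have hTfg : T.FG :=
    Submodule.fg_of_fg_map_injective Ψ hΨinj ((hΛ.map imZ).of_le (Submodule.map_comap_le Ψ _))
  obtain ⟨G, hG⟩ := hTfg
  refine ⟨∑ t ∈ G, ‖ι t‖, fun r hr ↦ ?_⟩
  -- `σ(r) ∈ T`
  have hrT : D.σ r ∈ T := by
    rw [hT, Submodule.mem_comap, hΨ, ← D.im_rayMoment_eq r hr, ← himZ]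
    exact Submodule.mem_map_of_mem (hmem r hr)
  rw [← hG] at hrT
  refine Submodule.span_induction (p := fun q _ ↦ ‖ι q‖ ≤ ∑ t ∈ G, ‖ι t‖) ?_ ?_ ?_ ?_ hrT
  · intro t ht
    exact Finset.single_le_sum (f := fun t ↦ ‖ι t‖) (fun _ _ ↦ norm_nonneg _) ht
  · simpa using Finset.sum_nonneg fun t (_ : t ∈ G) ↦ norm_nonneg (ι t)
  · intro x y _ _ hx hy
    rw [map_add]
    exact (IsUltrametricDist.norm_add_le_max _ _).trans (max_le hx hy)
  · intro n x _ hx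
    rw [map_zsmul, zsmul_eq_mul, norm_mul]
    have hn : ‖(n : PadicAlgCl p)‖ ≤ 1 := by
      rw [← map_intCast (algebraMap ℚ_[p] (PadicAlgCl p)), norm_algebraMap']
      exact Padic.norm_int_le_one n
    calc _ ≤ 1 * ∑ t ∈ G, ‖ι t‖ :=
          mul_le_mul hn hx (norm_nonneg _) zero_le_one
      _ = _ := one_mul _

/-- **Bounded symbols in even weight `n + 2 ≥ 4`**: the ray integrals at admissible cusps lie in
the finitely generated group of Manin's theorem (`IsNewform0.exists_fg_rayMoment_rat_mem`;
Shimura 1977, Thm. 1 / Manin 1973, Thm. 1.3). [cite: Shimura1977, Thm. 1] -/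
theorem PeriodSymbolDatum.exists_norm_le_of_even {n : ℕ} (hn : Even n) (hn0 : n ≠ 0)
    {g : CuspForm (Gamma0 N) (n + 2)} (hg : IsNewform0 g) (D : PeriodSymbolDatum g)
    (ι : coeffField g →+* PadicAlgCl p) :
    ∃ B : ℝ, ∀ r : ℚ, IsCoprime (r.den : ℤ) (N : ℤ) → ‖ι (D.σ r)‖ ≤ B := by
  obtain ⟨Λ, hΛ, -, hmem⟩ := hg.exists_fg_rayMoment_rat_mem hn hn0
  exact D.exists_norm_le_of_fg ι hΛ fun r hr ↦ hmem r hr 0 (Nat.zero_le n)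

/-- **Bounded symbols in weight `2`**: `∫_r^{i∞} g dz = (i/2π){∞, r}_g` and one positive integer
`n₀` with `n₀{∞, r}_g ∈ Λ_g` for all `r` (uniform Manin–Drinfeld,
`exists_forall_nsmul_modularSymbol_mem_periodLattice` with `exists_nsmul_modularSymbol_mem_periodLattice_holds`),
`Λ_g` the finitely generated period lattice (`periodLattice_fg`; Manin 1972, Cor. 3.6, Thm. 1.9).
[cite: Manin1972, Cor. 3.6] -/
theorem PeriodSymbolDatum.exists_norm_le_weight_two {g : CuspForm (Gamma0 N) 2}
    (D : PeriodSymbolDatum g) (ι : coeffField g →+* PadicAlgCl p) :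
    ∃ B : ℝ, ∀ r : ℚ, IsCoprime (r.den : ℤ) (N : ℤ) → ‖ι (D.σ r)‖ ≤ B := by
  obtain ⟨n₀, hn₀, hΛ⟩ := exists_forall_nsmul_modularSymbol_mem_periodLattice g
    (exists_nsmul_modularSymbol_mem_periodLattice_holds g)
  set c : ℂ := I / (2 * Real.pi * n₀) with hc
  let mulc : ℂ →ₗ[ℤ] ℂ := (AddMonoidHom.mulLeft c).toIntLinearMap
  have hfg : (AddSubgroup.toIntSubmodule (periodLattice g)).FG := by
    rw [Submodule.fg_iff_addSubgroup_fg, AddSubgroup.toIntSubmodule_toAddSubgroup]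
    exact periodLattice_fg g
  refine D.exists_norm_le_of_fg ι (hfg.map mulc) fun r _ ↦ ?_
  have hn0' : (n₀ : ℂ) ≠ 0 := by exact_mod_cast hn₀.ne'
  have hpi : (Real.pi : ℂ) ≠ 0 := by exact_mod_cast Real.pi_ne_zero
  have hray : rayMoment ⇑g 0 (r : ℝ) = c * (n₀ • modularSymbol g r) := by
    rw [rayMoment_def, modularSymbol, nsmul_eq_mul, hc]
    simp only [pow_zero, mul_one, ofReal_ratCast]
    field_simp
  rw [hray]
  exact Submodule.mem_map_of_mem (f := mulc)
    (show n₀ • modularSymbol g r ∈ AddSubgroup.toIntSubmodule (periodLattice g) from hΛ r)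

/-- **A newform on `Γ₀(N)` has even weight** (`−1 ∈ Γ₀(N)` kills odd weight, the tree's
`eq_zero_of_odd_weight_gamma0`; a newform is non-zero). [cite: DiamondShurman2005, §4.3 (p. 119)] -/
theorem IsNewform0.even_weight (hg : IsNewform0 g) : Even k := by
  by_contra hk
  rw [Int.not_even_iff_odd] at hk
  exact IsNormalized.ne_zero hg.2.2 (eq_zero_of_odd_weight_gamma0 _ hk g)

end Bounded

/-! ### Assembly -/

section Assembly

variable {N : ℕ} [NeZero N] {p : ℕ} [Fact p.Prime] {k : ℤ} {g : CuspForm (Gamma0 N) k}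

/-- **The cyclotomic `p`-adic `L`-function of an ordinary newform, given bounded symbols**
(Mazur–Tate–Teitelbaum 1986, §I.10–I.14): for a newform `g ∈ S_k(Γ₀(N))`, `k ≥ 2`, `p ∤ N`,
`ι : K_g → ℚ̄_p`, a unit root `υ` of `X² − ι(a_p)X + p^{k−1}`, and a period–symbol datum `D` whose
symbols are `ι`-bounded on the admissible cusps, the transform of the datum distribution is an
`L ∈ ℚ̄_p⟦T⟧` with `IsCycPAdicLFunctionWeightK g D p ι υ L`, bounded coefficients, all in the finite
extension `ℚ_p(ι K_g, υ)`. [cite: MazurTateTeitelbaum1986Invent, §I.14 (14.3)] -/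
theorem exists_isCycPAdicLFunctionWeightK_of_norm_le (hg : IsNewform0 g) (hk : 2 ≤ k)
    (hpN : ¬ p ∣ N) (ι : coeffField g →+* PadicAlgCl p) {υ : PadicAlgCl p}
    (hυ : υ ^ 2 - ι ⟨(qExpansion 1 ⇑g).coeff p, coeff_mem_coeffField g p⟩ * υ +
      (p : PadicAlgCl p) ^ (k - 1).toNat = 0)
    (hυ1 : ‖υ‖ = 1) (D : PeriodSymbolDatum g) {B : ℝ}
    (hB : ∀ r : ℚ, IsCoprime (r.den : ℤ) (N : ℤ) → ‖ι (D.σ r)‖ ≤ B) :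
    ∃ L : PowerSeries (PadicAlgCl p), IsCycPAdicLFunctionWeightK g D p ι υ L ∧
      (∃ C : ℝ, ∀ i, ‖PowerSeries.coeff i L‖ ≤ C) ∧
      ∃ K : IntermediateField ℚ_[p] (PadicAlgCl p), FiniteDimensional ℚ_[p] K ∧
        ∀ i, PowerSeries.coeff i L ∈ K := by
  have hυ0 : υ ≠ 0 := fun h ↦ by rw [h, norm_zero] at hυ1; exact zero_ne_one hυ1
  -- the distribution of the datum
  set μ : (m : ℕ) → ZMod (p ^ m) → PadicAlgCl p := fun m a ↦ υ⁻¹ ^ m *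
    (ι (D.σ ((a.val : ℚ) / (p : ℚ) ^ m)) -
      (p : PadicAlgCl p) ^ (k - 2).toNat * υ⁻¹ * ι (D.σ ((p : ℚ) * ((a.val : ℚ) / (p : ℚ) ^ m))))
    with hμdef
  have hμ : ∀ (m : ℕ) (a : ZMod (p ^ m)), μ m a = υ⁻¹ ^ m *
      (ι (D.σ ((a.val : ℚ) / (p : ℚ) ^ m)) -
        (p : PadicAlgCl p) ^ (k - 2).toNat * υ⁻¹ * ι (D.σ ((p : ℚ) * ((a.val : ℚ) / (p : ℚ) ^ m)))) :=
    fun _ _ ↦ rfl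
  have hdist := sum_fiber_mttDatum D ι hg hpN hk hυ hυ0 hμ
  have hC := norm_mttDatum_le D ι hpN hB hυ1 hμ
  -- the coefficient field `ℚ_p(ι K_g, υ)`
  set F : IntermediateField ℚ_[p] (PadicAlgCl p) := IntermediateField.adjoin ℚ_[p] (Set.range ι ∪ {υ})
    with hF
  haveI : FiniteDimensional ℚ (coeffField g) := IsNewform0.finiteDimensional_coeffField_holds hg
  haveI : FiniteDimensional ℚ_[p] F := finiteDimensional_padicCoeffField_range_union_singleton ι υ
  have hμF : ∀ (m : ℕ) (a : ZMod (p ^ m)), μ m a ∈ F := mttDatum_mem_adjoin D ι hμ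
  obtain ⟨L, hLC, hLF, hL0, hLχ⟩ := exists_powerSeries_of_bounded_distribution_algCl hμF hdist hC
  refine ⟨L, ⟨?_, ?_⟩, hLC, F, inferInstance, hLF⟩
  · rw [hL0, mttDatum_zero_sub_one D ι hμ]
  · intro m hm χ hprim heven hord
    obtain ⟨m, rfl⟩ := Nat.exists_eq_succ_of_ne_zero hm.ne'
    rw [← sum_mul_mttDatum_of_isPrimitive D ι hpN hμ m χ hprim]
    exact hLχ m χ heven hord

/-- **Mazur–Tate–Teitelbaum 1986, §I.10–I.14 — existence of the cyclotomic `p`-adic `L`-function of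
an ordinary newform of weight `k ≥ 2` with coefficients in `ℚ̄_p`: the named fact
`exists_isCycPAdicLFunctionWeightK` HOLDS.**  Weight `2`: `exists_norm_le_weight_two`; even weight
`≥ 4`: `exists_norm_le_of_even`; odd weight is empty on `Γ₀(M)` (`IsNewform0.even_weight`); then
`exists_isCycPAdicLFunctionWeightK_of_norm_le`. [cite: MazurTateTeitelbaum1986Invent, §I.11 and §I.14 (14.3)] -/
theorem exists_isCycPAdicLFunctionWeightK_holds : exists_isCycPAdicLFunctionWeightK := by
  intro M _ k g hg hk p _ hpM ι υ hυ hυ1 D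
  rcases eq_or_lt_of_le hk with hk2 | hk2
  · subst hk2
    obtain ⟨B, hB⟩ := D.exists_norm_le_weight_two ι
    exact exists_isCycPAdicLFunctionWeightK_of_norm_le hg le_rfl hpM ι hυ hυ1 D hB
  · obtain ⟨n, rfl⟩ : ∃ n : ℕ, k = (n : ℤ) + 2 := ⟨(k - 2).toNat, by omega⟩
    have hn0 : n ≠ 0 := by omega
    have hn : Even n := by
      have he := hg.even_weight
      rcases Nat.even_or_odd n with h | h
      · exact h
      · exfalso
        rw [Int.even_add, Int.even_coe_nat] at he
        exact (Nat.not_even_iff_odd.mpr h) (he.mpr (by decide))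
    obtain ⟨B, hB⟩ := D.exists_norm_le_of_even hn hn0 hg ι
    exact exists_isCycPAdicLFunctionWeightK_of_norm_le hg hk hpM ι hυ hυ1 D hB

end Assembly

end Literature.NumberTheory.EllipticCurves.ModularForms

end
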